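import Literature.Computability.Cryptography.ClassBQP
import Literature.Computability.Cryptography.QuantumCircuitDescFP
import Literature.Computability.Complexity.ListFoldBricks
import Literature.Computability.Complexity.FoldBricks
import Literature.Computability.Complexity.ReductionsProofs
import HarnessLib

/-!
# `BQP` relative to the empty oracle is `BQP` (`BQPRel_zero` discharged)

Sibling proof file of `ClassBQP.lean` (next to `ClassBQPProofs.lean`, which holds `P ⊆ BQP`) for
the named fact `Literature.Computability.Cryptography.BQPRel_zero : BQPRel 0 = BQP` (D-0014: the
fact stays a `def`; here `BQPRel_zero_holds : BQPRel_zero`).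

**Source.** Bernstein–Vazirani, *Quantum complexity theory*, SIAM J. Comput. 26 (1997), §8.3
(oracle QTMs): a query with the query track in state `|x · b⟩` leaves it in state
`|x · b ⊕ f(x)⟩`, `f` the Boolean function computed by the oracle, and "except for the query tape
and internal control, other parts of the oracle QTM do not change during the query";
`BQTime(T(n))^O` is the class of languages accepted with probability `≥ 2/3` by some oracle QTM
`M^O` running in time `T(n)`. In the tree's uniform-circuit form (`ClassBQP.lean`, `BQPRel A`:
poly-time uniform Clifford+T families with XOR-query gates `oracleGate A k`,
`|q, b⟩ ↦ |q, b ⊕ [q ∈ A]⟩`) the empty oracle `A = 0 = ∅` computes `f ≡ 0`, so every oracle gate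
is the identity (`QGate.toMatrix_zero_oracle`); deleting the oracle gates of each circuit of the family
(`QCircuit.stripOracles`, `QCircuitFamily.stripOracles`) therefore does not change its matrix under
the empty oracle (`QCircuit.toMatrix_zero_stripOracles`) nor its acceptance probabilities
(`QCircuitFamily.acceptProbOn_stripOracles`), and yields an oracle-free family. The one point that
needs work is that the stripped family is again **polynomial-time uniform**: by
`QCircuitFamily.isUniform_iff_descFn_mem_FP` (`QuantumCircuitDescFP.lean`) uniformity is membership
of the description function `1ⁿ ↦ ⟨bin n, ⟨1^{anc n}, encList (gate codes)⟩⟩` in `FP`, and the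
stripped description is obtained from the given one by the `FP` string function `stripDescFn`,
which folds over the coded gate list (`Brick.foldFn`, `ListFoldBricks.lean`) keeping exactly the
codes whose tag bit is `0` (gate symbols; oracle gates are tagged `1`, `QGate.encode`) —
`QCircuitFamily.descFn_stripOracles`, `QCircuitFamily.IsUniform.stripOracles`. Hence
`BQPRel 0 ⊆ BQP` (`BQPRel_zero_subset_BQP`); the reverse inclusion is `BQP_subset_BQPRel 0`
(`ClassBQP.lean`).

## Contents

* `QGate.toMatrix_zero_oracle` — placed oracle gates are the identity under the empty oracle;
* `QCircuit.stripGates`, `QCircuit.stripOracles`, `QCircuitFamily.stripOracles` — deleting the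
  oracle gates; `…_isOracleFree`, `stripGates_eq_filter`, `toMatrix_zero_stripOracles`,
  `acceptProbOn_stripOracles`;
* the string level: `QCircuit.map_encode_stripGates` (the codes of the kept gates are the codes
  with tag bit `0`), `stripDescStep`/`stripDescFn` (`∈ FP`, `stripDescFn_apply`),
  `QCircuitFamily.descFn_stripOracles`, `QCircuitFamily.IsUniform.stripOracles`;
* `BQPRel_zero_subset_BQP`, **`BQPRel_zero_holds`**.

## References

* E. Bernstein, U. Vazirani, *Quantum complexity theory*, SIAM J. Comput. 26 (1997) 1411–1473,
  §8.3 (oracle QTMs; `BQTime(T(n))^O`) [BernsteinVazirani1997].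
* S. Arora, B. Barak, *Computational Complexity: A Modern Approach*, CUP 2009, §6.2 (P-uniform
  families, Remark 6.7), §1.3 (closure of polynomial time under composition) [AroraBarak2009].
* M. A. Nielsen, I. L. Chuang, *Quantum Computation and Quantum Information*, CUP 2010, §6.1.1
  (the oracle `|x⟩|q⟩ ↦ |x⟩|q ⊕ f(x)⟩`) [NielsenChuang2010].

## Design notes

* The identity `oracleGate 0 k = 1` exists in the tree as
  `Literature.Barriers.QuantumAdvantage.oracleGate_zero`
  (`Barriers/QuantumAdvantage/UncorrectedNoiseIQP.lean`), far above this file in the import graph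
  (IQP sampling); it is re-derived inline inside `QGate.toMatrix_zero_oracle` (8 lines) rather
  than imported or re-declared.
* `stripGates` is defined by structural recursion on the gate list (so that the matrix and code
  identities are definitional case splits); `stripGates_eq_filter` identifies it with
  `List.filter QGate.IsOracleFree`.
-/

namespace Literature.Computability.Cryptography

open _root_.Computability Complexity Complexity.Brick Complexity.HashBricks Matrix

variable {G : QGateSet}

/-! ### Oracle gates under the empty oracle -/

/-- **Under the empty oracle a placed oracle gate is the identity**: with `A = ∅` the XOR query
`|q, b⟩ ↦ |q, b ⊕ [q ∈ A]⟩` is `|q, b⟩ ↦ |q, b⟩`, i.e. `oracleGate 0 k = 1` (this identity is the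
tree's `Literature.Barriers.QuantumAdvantage.oracleGate_zero`, re-derived inline to keep the
imports of this file low), and placing the identity gives the identity (`placeGate_one`).
[cite: BernsteinVazirani1997, §8.3 (oracle QTMs: the query |x·b⟩ ↦ |x·b ⊕ f(x)⟩)] -/
theorem QGate.toMatrix_zero_oracle {n : ℕ} (k : ℕ) (e : Fin (k + 1) ↪ Fin n) :
    (QGate.oracle k e : QGate G n).toMatrix 0 = 1 := by
  have hgate : oracleGate (0 : Language Bool) k = 1 := by
    ext x y
    simp only [oracleGate, Matrix.of_apply, Matrix.one_apply]
    have h0 : ∀ l : List Bool, (0 : Language Bool).boolIndicator l = false := by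
      intro l; simp [Set.boolIndicator, Language.zero_def]
    simp only [h0, Bool.xor_false]
    by_cases hxy : x = y
    · subst hxy; simp
    · rw [if_neg hxy, if_neg]
      rintro ⟨h1, h2⟩
      apply hxy
      funext i
      refine Fin.lastCases ?_ (fun j => ?_) i
      · exact h2
      · exact h1 j
  rw [QGate.toMatrix_oracle, hgate, placeGate_one]

/-! ### Deleting the oracle gates of a circuit -/

namespace QCircuit

variable {n : ℕ}

/-- Delete the oracle gates of a gate list (keep the gate symbols, in order). [cite: BernsteinVazirani1997, §8.3 (oracle QTMs)] -/
def stripGates : List (QGate G n) → List (QGate G n)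
  | [] => []
  | .gate s e :: gs => .gate s e :: stripGates gs
  | .oracle _ _ :: gs => stripGates gs

/-- `stripGates` is the filter by `QGate.IsOracleFree`. [folklore] -/
theorem stripGates_eq_filter : ∀ gs : List (QGate G n), stripGates gs = gs.filter fun g => g.IsOracleFree
  | [] => rfl
  | .gate s e :: gs => by
    rw [stripGates, List.filter_cons_of_pos (by simp [QGate.IsOracleFree]), stripGates_eq_filter gs]
  | .oracle k e :: gs => by
    rw [stripGates, List.filter_cons_of_neg (by simp [QGate.IsOracleFree]), stripGates_eq_filter gs]

/-- Every gate kept by `stripGates` is oracle-free. [folklore] -/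
theorem isOracleFree_of_mem_stripGates : ∀ (gs : List (QGate G n)) (g : QGate G n), g ∈ stripGates gs → g.IsOracleFree
  | [], g, h => absurd h (by simp [stripGates])
  | .gate s e :: gs, g, h => by
    rw [stripGates, List.mem_cons] at h
    rcases h with rfl | h
    · trivial
    · exact isOracleFree_of_mem_stripGates gs g h
  | .oracle k e :: gs, g, h => by
    rw [stripGates] at h
    exact isOracleFree_of_mem_stripGates gs g h

/-- **Under the empty oracle, deleting the oracle gates does not change the matrix of a gate
list** (each deleted gate is the identity, `QGate.toMatrix_zero_oracle`). [cite: BernsteinVazirani1997, §8.3 (oracle QTMs)] -/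
theorem toMatrix_zero_stripGates : ∀ gs : List (QGate G n),
    (⟨stripGates gs⟩ : QCircuit G n).toMatrix 0 = (⟨gs⟩ : QCircuit G n).toMatrix 0
  | [] => rfl
  | .gate s e :: gs => by rw [stripGates, toMatrix_cons, toMatrix_cons, toMatrix_zero_stripGates gs]
  | .oracle k e :: gs => by
    rw [stripGates, toMatrix_cons, toMatrix_zero_stripGates gs, QGate.toMatrix_zero_oracle, mul_one]

/-- The circuit with its oracle gates deleted. [cite: BernsteinVazirani1997, §8.3 (oracle QTMs)] -/
def stripOracles (C : QCircuit G n) : QCircuit G n := ⟨stripGates C.gates⟩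

/-- The gates of the stripped circuit (definitional). [folklore] -/
@[simp] theorem gates_stripOracles (C : QCircuit G n) : C.stripOracles.gates = stripGates C.gates := rfl

/-- The stripped circuit is oracle-free. [folklore] -/
theorem stripOracles_isOracleFree (C : QCircuit G n) : C.stripOracles.IsOracleFree :=
  fun g hg => isOracleFree_of_mem_stripGates C.gates g hg

/-- **Under the empty oracle the stripped circuit computes the same matrix.** [cite: BernsteinVazirani1997, §8.3 (oracle QTMs)] -/
theorem toMatrix_zero_stripOracles (C : QCircuit G n) : C.stripOracles.toMatrix 0 = C.toMatrix 0 := by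
  obtain ⟨gs⟩ := C
  exact toMatrix_zero_stripGates gs

/-- The stripped circuit is no larger. [folklore] -/
theorem size_stripOracles_le (C : QCircuit G n) : C.stripOracles.size ≤ C.size := by
  simp only [size, gates_stripOracles, stripGates_eq_filter]
  exact List.length_filter_le _ _

end QCircuit

namespace QCircuitFamily

/-- The family with the oracle gates of every circuit deleted (same ancillas). [cite: BernsteinVazirani1997, §8.3 (oracle QTMs)] -/
def stripOracles (F : QCircuitFamily G) : QCircuitFamily G :=
  ⟨F.ancillas, fun n => (F.circ n).stripOracles⟩

/-- The ancillas of the stripped family (definitional). [folklore] -/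
@[simp] theorem ancillas_stripOracles (F : QCircuitFamily G) (n : ℕ) : F.stripOracles.ancillas n = F.ancillas n := rfl

/-- The circuits of the stripped family (definitional). [folklore] -/
theorem circ_stripOracles (F : QCircuitFamily G) (n : ℕ) : F.stripOracles.circ n = (F.circ n).stripOracles := rfl

/-- The stripped family is oracle-free. [folklore] -/
theorem stripOracles_isOracleFree (F : QCircuitFamily G) : F.stripOracles.IsOracleFree :=
  fun n => (F.circ n).stripOracles_isOracleFree

/-- **Under the empty oracle the stripped family has the same acceptance probabilities.** [cite: BernsteinVazirani1997, §8.3 (oracle QTMs)] -/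
theorem acceptProbOn_stripOracles (F : QCircuitFamily G) (x : List Bool) :
    F.stripOracles.acceptProbOn 0 x = F.acceptProbOn 0 x := by
  show ((F.circ x.length).stripOracles).acceptProb 0 x.get = (F.circ x.length).acceptProb 0 x.get
  simp only [QCircuit.acceptProb, QCircuit.runOn, QCircuit.toMatrix_zero_stripOracles]

end QCircuitFamily

/-! ### The string level: stripping the coded gate list is in `FP` -/

section Codes

variable [Encodable G.Op] {n : ℕ}

/-- The tag bit of the code of a gate symbol is `0`. [folklore] -/
theorem QGate.headD_encode_gate (s : G.Op) (e : Fin (G.arity s) ↪ Fin n) :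
    (QGate.gate s e : QGate G n).encode.headD false = false := rfl

/-- The tag bit of the code of an oracle gate is `1`. [folklore] -/
theorem QGate.headD_encode_oracle (k : ℕ) (e : Fin (k + 1) ↪ Fin n) :
    (QGate.oracle k e : QGate G n).encode.headD false = true := rfl

/-- **The codes of the kept gates are the codes with tag bit `0`.** [cite: AroraBarak2009, §6.1 (descriptions of circuits)] -/
theorem QCircuit.map_encode_stripGates : ∀ gs : List (QGate G n),
    (QCircuit.stripGates gs).map QGate.encode = (gs.map QGate.encode).filter fun a => !(a.headD false)
  | [] => rfl
  | .gate s e :: gs => by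
    rw [QCircuit.stripGates, List.map_cons, List.map_cons,
      List.filter_cons_of_pos (by simp only [QGate.headD_encode_gate, Bool.not_false]), map_encode_stripGates gs]
  | .oracle k e :: gs => by
    rw [QCircuit.stripGates, List.map_cons,
      List.filter_cons_of_neg (by simp only [QGate.headD_encode_oracle, Bool.not_true]; exact Bool.false_ne_true),
      map_encode_stripGates gs]

end Codes

/-- **The step of the stripping fold** on step arguments `⟨w, ⟨a, acc⟩⟩` (`a` the current gate
code, `acc` the codes kept so far): if `a` starts with `1` (an oracle gate) keep `acc`, otherwise
append the item `⟨a, ε⟩` to `acc`. [cite: AroraBarak2009, §1.3 (bounded loops)] -/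
noncomputable def stripDescStep : List Bool → List Bool :=
  iteFn (headBitFn ∘ fstF ∘ sndF) (sndF ∘ sndF)
    (appF ∘ fanoutFn (sndF ∘ sndF) (fanoutFn (fstF ∘ sndF) (fun _ => [])))

/-- Value of `stripDescStep` on a step argument. [folklore] -/
theorem stripDescStep_apply (w a acc : List Bool) :
    stripDescStep (boolPair w (boolPair a acc)) = if a.headD false then acc else acc ++ boolPair a [] := by
  have hc : (headBitFn ∘ fstF ∘ sndF) (boolPair w (boolPair a acc)) = [a.headD false] := by simp
  rw [stripDescStep, iteFn_apply hc]
  split_ifs <;> simp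

/-- `stripDescStep ∈ FP`. [folklore] -/
theorem stripDescStep_mem_FP : stripDescStep ∈ FP :=
  iteFn_mem_FP (comp_mem_FP headBitFn_mem_FP (comp_mem_FP fstF_mem_FP sndF_mem_FP)) (comp_mem_FP sndF_mem_FP sndF_mem_FP)
    (comp_mem_FP appF_mem_FP (fanoutFn_mem_FP (comp_mem_FP sndF_mem_FP sndF_mem_FP)
      (fanoutFn_mem_FP (comp_mem_FP fstF_mem_FP sndF_mem_FP) (const_mem_FP _))))

/-- Total growth of `stripDescStep`: `|stripDescStep ⟨u, ⟨a, acc⟩⟩| ≤ |acc| + 2|a| + 2`, in the format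
`FoldGrowth 2` of `Brick.foldFn_mem_FP`. [folklore] -/
theorem foldGrowth_stripDescStep : FoldGrowth 2 stripDescStep := fun v => by
  rw [stripDescStep, iteFn_of_oneBit (oneBit_headBitFn.comp _)]
  split_ifs
  · simp only [Function.comp_apply]; omega
  · simp only [Function.comp_apply, fanoutFn_apply, appF_boolPair, List.length_append, length_boolPair, List.length_nil]
    omega

/-- The left fold of the keep-step concatenates the kept items: it appends the code of the
sublist of items with tag bit `0`. [folklore] -/
theorem foldl_stripDescStep_eq : ∀ (l : List (List Bool)) (acc : List Bool),
    l.foldl (fun acc a => if a.headD false then acc else acc ++ boolPair a []) acc =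
      acc ++ encList (l.filter fun a => !(a.headD false))
  | [], acc => by simp
  | a :: l, acc => by
    rw [List.foldl_cons, List.filter_cons]
    cases h : a.headD false
    · rw [if_neg (by simp), foldl_stripDescStep_eq l, if_pos (by simp), encList_cons, List.append_assoc]
      simp [boolPair]
    · rw [if_pos rfl, foldl_stripDescStep_eq l, if_neg (by simp)]

/-- **Stripping at the string level**: `⟨u, ⟨v, L⟩⟩ ↦ ⟨u, ⟨v, L'⟩⟩` with `L'` the code of the
sublist of items of `L` with tag bit `0` (a fold over the items of `L`, `Brick.foldFn`). [cite: AroraBarak2009, §1.3 (bounded loops); §6.2 Remark 6.7] -/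
noncomputable def stripDescFn : List Bool → List Bool :=
  fanoutFn fstF (fanoutFn (fstF ∘ sndF) (foldFn stripDescStep (fun _ => []) ∘ sndF))

/-- **`stripDescFn ∈ FP`.** [cite: AroraBarak2009, §1.3 (closure of polynomial time under composition and bounded loops)] -/
theorem stripDescFn_mem_FP : stripDescFn ∈ FP :=
  fanoutFn_mem_FP fstF_mem_FP (fanoutFn_mem_FP (comp_mem_FP fstF_mem_FP sndF_mem_FP)
    (comp_mem_FP (foldFn_mem_FP stripDescStep_mem_FP (const_mem_FP _) foldGrowth_stripDescStep) sndF_mem_FP))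

/-- **Value of `stripDescFn` on a description**: the coded gate list is filtered by the tag bit.
[folklore] -/
theorem stripDescFn_apply (u v : List Bool) (codes : List (List Bool)) :
    stripDescFn (boolPair u (boolPair v (encList codes))) =
      boolPair u (boolPair v (encList (codes.filter fun a => !(a.headD false)))) := by
  simp only [stripDescFn, fanoutFn_apply, fstF_boolPair, sndF_boolPair, Function.comp_apply, foldFn_boolPair,
    decNil_encList, stripDescStep_apply]
  rw [foldl_stripDescStep_eq, List.nil_append]

namespace QCircuitFamily

variable [Encodable G.Op]

/-- **The description of the stripped family is `stripDescFn` of the description.** [cite: AroraBarak2009, §6.2 (P-uniform circuit families) and Remark 6.7] -/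
theorem descFn_stripOracles (F : QCircuitFamily G) : F.stripOracles.descFn = stripDescFn ∘ F.descFn := by
  funext z
  rw [Function.comp_apply, descFn_eq, descFn_eq, QCircuit.encode_eq_encList, QCircuit.encode_eq_encList,
    stripDescFn_apply, ← QCircuit.map_encode_stripGates]
  rfl

/-- **Deleting the oracle gates keeps a family polynomial-time uniform** ("can be deleted
uniformly": compose the description machine with the `FP` filter `stripDescFn`). [cite: AroraBarak2009, §6.2 (P-uniform circuit families) and Remark 6.7] -/
theorem IsUniform.stripOracles {F : QCircuitFamily G} (hU : F.IsUniform) : F.stripOracles.IsUniform :=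
  isUniform_of_descFn_mem_FP (by
    rw [descFn_stripOracles]
    exact comp_mem_FP stripDescFn_mem_FP (descFn_mem_FP_of_isUniform hU))

end QCircuitFamily

/-! ### `BQP^∅ = BQP` -/

/-- **`BQP^∅ ⊆ BQP`**: a uniform family deciding `L` relative to the empty oracle, with its
oracle gates (identities) deleted, is an oracle-free uniform family deciding `L` with the same
acceptance probabilities. [cite: BernsteinVazirani1997, §8.3 (oracle QTMs; BQTime(T(n))^O)] -/
theorem BQPRel_zero_subset_BQP : BQPRel 0 ⊆ BQP := by
  rintro L ⟨F, hU, hL⟩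
  refine ClassBQP.mem_BQP_iff.2 ⟨F.stripOracles, F.stripOracles_isOracleFree, hU.stripOracles, fun x => ?_⟩
  rw [QCircuitFamily.acceptProbOn_stripOracles]
  exact hL x

/-- **`BQP` relative to the empty oracle is `BQP`** (`BQPRel 0 = BQP`), the discharge of the named
fact `Literature.Computability.Cryptography.BQPRel_zero`: `⊆` is `BQPRel_zero_subset_BQP` (oracle
gates of the empty oracle are identities and are deleted uniformly), `⊇` is `BQP_subset_BQPRel 0`
(oracle-free families do not see the oracle). [cite: BernsteinVazirani1997, §8.3 (oracle QTMs; BQTime(T(n))^O)] -/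
theorem BQPRel_zero_holds : BQPRel_zero :=
  Set.Subset.antisymm BQPRel_zero_subset_BQP (BQP_subset_BQPRel 0)

end Literature.Computability.Cryptography
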